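import Summits.ResolutionOfSingularities.ResolutionOfSingularities.Theorems.MonomialBlowupLU
import HarnessLib

/-!
# MonomialBlowupLU2 — the layer-3 ENGINE `exists_quasiFinite_of_monomialBlowup` (E-frame `k ⊆ M ⊆ K′ ⊆ M(η) ⊆ E`, hypothesis-free)

One of the four landing files of the g30 node «MonomialBlowup» of the ROOT/RESIDUAL decomposition cell `decomp-res`
(lens 1; Door B of NEXT-g30, critic rows 207 / 223 / 223c; files `MonomialBlowupLU`, `…LU2`, `…LU3`, `…LU4`); see the
module docstring of `Summits.ResolutionOfSingularities.ResolutionOfSingularities.Theorems.MonomialBlowupLU` for the thesis ([CossartPiltant2008,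
Prop. 9.3] LAYER 3 in every dimension), the cell `MonomialBlowupAbove k O` and the law
`quasiFiniteLUAbove_of_monomialBlowupAbove : MonomialBlowupAbove k O → QuasiFiniteLUAbove k O` (in `…LU3`), the
costume diff, the paper instance and the sources.  This file: the engine only ([CoP1] (44), (46)–(52) above every normal model, assembled from tree theorems by name).
Imports: the landed `…MonomialBlowupLU` (PART A tools) only.  Problem side, sorry-free, hypothesis-free (zero fact binders); every heavy theorem carries
`set_option maxHeartbeats … in` BEFORE its docstring — keep it.
-/

noncomputable section

open IsLocalRing Polynomial IntermediateField Literature.AlgebraicGeometry.Resolution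
open Summit.ResolutionOfSingularities.ResolutionOfSingularities.Theorems.DecompositionDescentLU
open scoped Pointwise

namespace Summit.ResolutionOfSingularities.ResolutionOfSingularities.Theorems.MonomialBlowupLU

universe u


/-! ## PART B (engine frame `k ⊆ M ⊆ K′ ⊆ M(η) ⊆ E`) — LAYER 3 OF [CossartPiltant2008, Prop. 9.3]: from the OUTPUT of
Prop. 8.1 above every normal model to a QUASI-FINITE regular model cut out by `M`-functions (hypothesis-free) -/

section Engine3

variable {E : Type u} [Field E] (OE : ValuationSubring E) {M : Subfield E}

set_option maxHeartbeats 3200000 in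
/-- **ENGINE OF LAYER 3 — [CossartPiltant2008, proof of Prop. 9.3, (46)–(52)] in ARBITRARY dimension,
hypothesis-free.**  Frame: `k ⊆ M ⊆ K′ ⊆ M(η) ⊆ E` with `E | M` normal, `η ∈ O_E` a Hensel root over
`O_E ∩ M` with `M`-rational residue (so `K′ | M` is finite separable inside the DECOMPOSITION FIELD of the Galois
closure `N` of `M(η)`: tree `closure_le_decompositionField`); `s ⊆ M ∩ O_E` a finite set generating `M` over `k`
(the model to dominate).  INPUT `hHead` = the OUTPUT OF [CoP1] Prop. 8.1 (1)–(2) with the (46)-choice, above EVERY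
normal affine model `k[t₁] ⊆ O_E` of `M` and every presentation `k[t₁ ∪ t₁′]` of its integral closure in `K′`
(cf. the hypothesis `hHead` of the tree's `Literature.…exists_localUniformization_of_head'`, here with base the
FIELD `k` and `Fin 3 ↦ Fin d`): a model `k[t′] ⊇ k[t₁ ∪ t₁′]` of `K′` inside `O_E`, REGULAR at the centre, with a
regular system of parameters `x₀, …, x_{d-1}` of `S′ := k[t′]_𝔪`, `0 < r ≤ d`, such that (a)
`𝔪_{R₁′}S′ ⊆ (x₀⋯x_{r-1})S′` (`R₁′ := k[t₁ ∪ t₁′]_𝔪`; Prop. 8.1 (2) `√(𝔪_{S₀}S) = (x₁⋯x_r)`), (b) `fᵢ ∈ M`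
(`i < r`) with `fᵢ = γᵢ ∏_{j<r} xⱼ^{aᵢⱼ}`, `γᵢ ∈ S′×`, `det(aᵢⱼ) ≠ 0` ((46): "`fᵢ = γᵢ ∏ xⱼ^{aᵢⱼ}` … the matrix
`A` is nonsingular"), (c) some `f ∈ R₁′`, a unit times a monomial in `x₀, …, x_{r-1}`, with `t′ ⊆ R₁′[1/f]`
(Prop. 8.1 (1) `(S₀)_f = S_f` and (2) `√(fS) = (x₁⋯x_r)`).  OUTPUT: a model `k[t] ⊆ O_E` of `K′` containing `s`,
regular at the centre, and a finite `F ⊆ M ∩ k[t]` of positive values RADICALLY CUTTING OUT the closed point —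
denominator-wise: every `y ∈ k[t]` of positive value has `b·yⁿ ∈ F·k[t]` with `v(b) = 0`.  Assembly (all tree,
by name): Galois closure and `K′ ⊆ Z` (`closure_le_decompositionField`); density constants `c ⊆ M ∩ O_E` with
"`R₁` lies dense in `R₁′`" for every normal model containing them (`exists_finset_dense_locAtCentre`, [CoP1]
(44)); the normal model `k[t₁] ⊇ k[s ∪ c]` (`exists_normal_model`) and its integral closure in `K′`
(`exists_adjoin_eq_integralClosure_extension`); the head; (47) from Prop. 8.1 (1)
(`exists_mem_eq_unit_mul_prod_pow`); (46)–(52) in dimension `d` (`exists_radical_eq_maximalIdeal_of_dense_fin`);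
`k[t] := k[t′, Fᵢ, Hⱼ]` has the same local ring `S′`; `Frac k[t₁ ∪ t₁′] = K′`
(`integralClosure.isFractionRing_of_finite_extension`); (52) cleared of denominators
(`exists_mul_mem_span_of_mem_span`).  No port, no named fact. (Sources: CossartPiltant2008, Prop. 8.1 and proof of
Prop. 9.3, (44), (46)–(52) (HAL pp. 21–22, 27–28); Abhyankar1959, Thm. 1.47.) -/
theorem exists_quasiFinite_of_monomialBlowup (k : Type u) [Field k] [Algebra k E]
    (hkM : ∀ c : k, algebraMap k E c ∈ M) (hkO : ∀ c : k, algebraMap k E c ∈ OE) [Normal M E]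
    {η : E} (hηO : η ∈ OE) {x₀ : E} (hx₀ : x₀ ∈ M) (hηx₀ : OE.valuation (η - x₀) < 1)
    {f : E[X]} (hfM : ∀ i, f.coeff i ∈ M) (hfO : ∀ i, f.coeff i ∈ OE) (hfη : f.eval η = 0)
    (hder : OE.valuation ((derivative f).eval η) = 1)
    (K' : Subfield E) (hMK' : M ≤ K') (hK'cl : K' ≤ Subfield.closure ((M : Set E) ∪ {η}))
    (s : Finset E) (hsM : (s : Set E) ⊆ M) (hsO : ∀ x ∈ s, x ∈ OE)
    (hMs : M ≤ Subfield.closure (Set.range (algebraMap k E) ∪ (s : Set E)))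
    (hHead : ∀ (t₁ : Finset E), (t₁ : Set E) ⊆ M →
        M ≤ Subfield.closure (Set.range (algebraMap k E) ∪ (t₁ : Set E)) →
        (Algebra.adjoin k (t₁ : Set E)).toSubring ≤ OE.toSubring →
        (∀ x : E, x ∈ M → IsIntegral (Algebra.adjoin k (t₁ : Set E)) x →
          x ∈ Algebra.adjoin k (t₁ : Set E)) →
      ∀ (t₁' : Finset E), (t₁' : Set E) ⊆ K' →
        (∀ x : E, x ∈ K' → (IsIntegral (Algebra.adjoin k (t₁ : Set E)) x ↔
          x ∈ Algebra.adjoin k ((t₁ : Set E) ∪ (t₁' : Set E)))) →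
      ∃ (t' : Finset E) (_ : (t' : Set E) ⊆ K')
        (hTO' : (Algebra.adjoin k (t' : Set E)).toSubring ≤ OE.toSubring)
        (_ : Algebra.adjoin k ((t₁ : Set E) ∪ (t₁' : Set E)) ≤ Algebra.adjoin k (t' : Set E))
        (_ : IsRegularLocalRing (locAtCentre (Algebra.adjoin k (t' : Set E)).toSubring OE))
        (d r : ℕ) (hr : r ≤ d) (_ : 0 < r)
        (x : Fin d → locAtCentre (Algebra.adjoin k (t' : Set E)).toSubring OE),
        (∀ j, ((x j : locAtCentre (Algebra.adjoin k (t' : Set E)).toSubring OE) : E) ≠ 0) ∧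
        (haveI := isLocalRing_locAtCentre hTO'
         Ideal.span (Set.range x) =
           maximalIdeal (locAtCentre (Algebra.adjoin k (t' : Set E)).toSubring OE)) ∧
        (∀ y : locAtCentre (Algebra.adjoin k (t' : Set E)).toSubring OE,
          (y : E) ∈ locAtCentre (Algebra.adjoin k ((t₁ : Set E) ∪ (t₁' : Set E))).toSubring OE →
          OE.valuation (y : E) < 1 →
          y ∈ Ideal.span {∏ i : Fin r, x (Fin.castLE hr i)}) ∧
        (∃ (f : Fin r → E) (γ : Fin r → (locAtCentre (Algebra.adjoin k (t' : Set E)).toSubring OE)ˣ)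
            (a : Matrix (Fin r) (Fin r) ℕ),
          (∀ i, f i ∈ M) ∧
          (∀ i, f i = ((γ i : locAtCentre (Algebra.adjoin k (t' : Set E)).toSubring OE) : E) *
            ∏ j, ((x (Fin.castLE hr j) :
              locAtCentre (Algebra.adjoin k (t' : Set E)).toSubring OE) : E) ^ a i j) ∧
          (a.map (fun n : ℕ => (n : ℤ))).det ≠ 0) ∧
        (∃ (f₁ : E) (w : (locAtCentre (Algebra.adjoin k (t' : Set E)).toSubring OE)ˣ)
            (e : Fin r → ℕ),
          f₁ ∈ locAtCentre (Algebra.adjoin k ((t₁ : Set E) ∪ (t₁' : Set E))).toSubring OE ∧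
          f₁ = ((w : locAtCentre (Algebra.adjoin k (t' : Set E)).toSubring OE) : E) *
            ∏ i, ((x (Fin.castLE hr i) :
              locAtCentre (Algebra.adjoin k (t' : Set E)).toSubring OE) : E) ^ e i ∧
          ∀ z ∈ (t' : Set E), ∃ n : ℕ,
            f₁ ^ n * z ∈ locAtCentre (Algebra.adjoin k ((t₁ : Set E) ∪ (t₁' : Set E))).toSubring OE)) :
    ∃ t : Finset E, (t : Set E) ⊆ K' ∧ (s : Set E) ⊆ Algebra.adjoin k (t : Set E) ∧
      (Algebra.adjoin k (t : Set E)).toSubring ≤ OE.toSubring ∧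
      K' ≤ Subfield.closure (Set.range (algebraMap k E) ∪ (t : Set E)) ∧
      IsRegularLocalRing (locAtCentre (Algebra.adjoin k (t : Set E)).toSubring OE) ∧
      ∃ F : Finset E, (F : Set E) ⊆ M ∧ (F : Set E) ⊆ Algebra.adjoin k (t : Set E) ∧
        (∀ x ∈ F, OE.valuation x < 1) ∧
        ∀ y ∈ Algebra.adjoin k (t : Set E), OE.valuation y < 1 →
          ∃ n : ℕ, ∃ b ∈ Algebra.adjoin k (t : Set E), OE.valuation b = 1 ∧
            b * y ^ n ∈ Submodule.span (Algebra.adjoin k (t : Set E)) (F : Set E) := by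
  classical
  haveI : IsAdicComplete (maximalIdeal k) k := by
    rw [(isField_iff_maximalIdeal_eq).mp (Field.toIsField k)]; infer_instance
  have hkK' : ∀ c : k, algebraMap k E c ∈ K' := fun c => hMK' (hkM c)
  -- (1) `η` integral separable over `M`; `K′ ⊆ M(η) ⊆ N` the Galois closure; `K′ ⊆ Z(N)`
  have hint : IsIntegral M η := isIntegral_of_henselRoot OE hfM hfη hder
  have hsep : IsSeparable M η := isSeparable_of_henselRoot OE hfM hfη hder
  let Lη : IntermediateField M E := M⟮η⟯
  haveI : FiniteDimensional M Lη := IntermediateField.adjoin.finiteDimensional hint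
  haveI : Algebra.IsSeparable M Lη :=
    (IntermediateField.isSeparable_adjoin_simple_iff_isSeparable M E).mpr hsep
  let N : IntermediateField M E := normalClosure M Lη E
  haveI : FiniteDimensional M N := normalClosure.is_finiteDimensional M Lη E
  haveI : Algebra.IsSeparable M N := by
    have h : ∀ g : Lη →ₐ[M] E, Algebra.IsSeparable M g.fieldRange := fun g =>
      AlgEquiv.Algebra.isSeparable (AlgEquiv.ofInjectiveField g)
    show Algebra.IsSeparable M (normalClosure M Lη E)
    rw [normalClosure_def]
    infer_instance
  haveI : IsGalois M N := isGalois_iff.mpr ⟨inferInstance, inferInstance⟩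
  have hLN : Lη ≤ N := IntermediateField.le_normalClosure Lη
  have hηL : η ∈ Lη := IntermediateField.mem_adjoin_simple_self M η
  have hZ := closure_le_decompositionField OE N (hLN hηL) hηO hx₀ hηx₀ hfM hfO hfη hder
  have hclL : Subfield.closure ((M : Set E) ∪ {η}) ≤ Lη.toSubfield := by
    refine Subfield.closure_le.mpr ?_
    rintro x (hx | hx)
    · exact Lη.algebraMap_mem ⟨x, hx⟩
    · rw [Set.mem_singleton_iff] at hx
      rw [hx]; exact hηL
  have hK'N : K' ≤ N.toSubfield := (hK'cl.trans hclL).trans hLN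
  have hK'Z : K' ≤ (IntermediateField.lift (fixedField (decompositionGroupIn OE N))).toSubfield :=
    hK'cl.trans hZ
  -- `K′` as an intermediate field, finite separable over `M`
  let K'M : IntermediateField M E := K'.toIntermediateField (fun x => hMK' x.2)
  have hmemK'M : ∀ y : E, y ∈ K'M ↔ y ∈ K' := fun _ => Iff.rfl
  have hrange : Set.range (algebraMap M E) = (M : Set E) := by
    ext z; constructor
    · rintro ⟨w, rfl⟩; exact w.2
    · intro hz; exact ⟨⟨z, hz⟩, rfl⟩
  have hK'Mle : K'M ≤ M⟮η⟯ := fun y hy => by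
    have h1 : y ∈ Subfield.closure ((M : Set E) ∪ {η}) := hK'cl ((hmemK'M y).mp hy)
    rw [← IntermediateField.mem_toSubfield, IntermediateField.adjoin_toSubfield, hrange]
    exact h1
  haveI : FiniteDimensional M K'M :=
    Module.Finite.of_injective (IntermediateField.inclusion hK'Mle).toLinearMap
      (IntermediateField.inclusion_injective hK'Mle)
  haveI : Algebra.IsSeparable M K'M :=
    Algebra.IsSeparable.of_algHom M _ (IntermediateField.inclusion hK'Mle)
  -- (2) density constants `c ⊆ M ∩ O_E` ([CoP1] (44): "`R₁` lies dense in `R₁′`")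
  obtain ⟨c, hcM, hcO, hdenseC⟩ := exists_finset_dense_locAtCentre k E OE M hkM N
  -- (3) the normal model `k[t₁] ⊇ k[s ∪ c]` of `M` inside `O_E`
  set t₀ : Finset E := s ∪ c with ht₀def
  have ht₀M : (t₀ : Set E) ⊆ M := by
    rw [ht₀def, Finset.coe_union]; exact Set.union_subset hsM hcM
  have ht₀O : ∀ x ∈ t₀, x ∈ OE := fun x hx => by
    rcases Finset.mem_union.mp hx with h | h
    · exact hsO x h
    · exact hcO x h
  have hMt₀ : M ≤ Subfield.closure (Set.range (algebraMap k E) ∪ (t₀ : Set E)) :=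
    hMs.trans (Subfield.closure_mono (Set.union_subset_union_right _
      (by rw [ht₀def, Finset.coe_union]; exact Set.subset_union_left)))
  obtain ⟨t₁, ht₀t₁, ht₁M, hMt₁, ht₁O, hnorm⟩ := exists_normal_model k E OE hkO M hkM t₀ ht₀M ht₀O hMt₀
  set B₁ : Subalgebra k E := Algebra.adjoin k (t₁ : Set E) with hB₁def
  have hct₁ : (c : Set E) ⊆ B₁ := fun z hz => Algebra.subset_adjoin (ht₀t₁ (by
    rw [ht₀def, Finset.coe_union]; exact Or.inr hz))
  have hst₁ : (s : Set E) ⊆ B₁ := fun z hz => Algebra.subset_adjoin (ht₀t₁ (by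
    rw [ht₀def, Finset.coe_union]; exact Or.inl hz))
  -- (4) its integral closure `k[t₁ ∪ t₁′]` in `K′`
  obtain ⟨t₁', ht₁'K, hBint, hext⟩ :=
    exists_adjoin_eq_integralClosure_extension k E M hkM K'M t₁ ht₁M hMt₁ hnorm
  have ht₁'K' : (t₁' : Set E) ⊆ K' := fun z hz => (hmemK'M z).mp (ht₁'K hz)
  have hext₁ : ∀ z : E, z ∈ K' → (IsIntegral B₁ z ↔
      z ∈ Algebra.adjoin k ((t₁ : Set E) ∪ (t₁' : Set E))) :=
    fun z hz => ⟨fun h => hext z ((hmemK'M z).mpr hz) h, fun h => hBint z h⟩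
  set B₁' : Subalgebra k E := Algebra.adjoin k ((t₁ : Set E) ∪ (t₁' : Set E)) with hB₁'def
  have hB₁B₁' : B₁ ≤ B₁' := Algebra.adjoin_mono Set.subset_union_left
  have hO₁' : B₁'.toSubring ≤ OE.toSubring := fun z hz =>
    mem_valuationSubring_of_isIntegral_model B₁ OE ht₁O (hBint z hz)
  -- (5) THE HEAD: [CoP1] Prop. 8.1 (1)–(2) + the (46)-choice, above `R₁′`
  obtain ⟨t', ht'K', hTO', hle', hregS', hrest⟩ := hHead t₁ ht₁M hMt₁ ht₁O hnorm t₁' ht₁'K' hext₁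
  set B' : Subalgebra k E := Algebra.adjoin k (t' : Set E) with hB'def
  set S' : Subring E := locAtCentre B'.toSubring OE with hS'def
  set R₁ : Subring E := locAtCentre B₁.toSubring OE with hR₁def
  set R₁' : Subring E := locAtCentre B₁'.toSubring OE with hR₁'def
  obtain ⟨d, r, hr, hr0, x, hx0, hxm, ha, ⟨fm, γ, A, hfmM, hfm, hdet⟩, f₁, w, e, hf₁R, hf₁, ht'f⟩ := hrest
  haveI hS'loc : IsLocalRing S' := isLocalRing_locAtCentre hTO'
  haveI hR₁'loc : IsLocalRing R₁' := isLocalRing_locAtCentre hO₁'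
  have hS'O : S' ≤ OE.toSubring := locAtCentre_le hTO'
  have h₁ : R₁' ≤ S' := locAtCentre_mono OE (fun z hz => hle' hz)
  have hB'S' : B'.toSubring ≤ S' := le_locAtCentre _ OE
  have hkS' : ∀ c : k, algebraMap k E c ∈ S' := fun c => hB'S' (B'.algebraMap_mem c)
  let MS : Subalgebra k E := { M.toSubring with algebraMap_mem' := hkM }
  have hB₁M : B₁.toSubring ≤ M.toSubring := fun z hz =>
    (Algebra.adjoin_le (S := MS) ht₁M : B₁ ≤ MS) hz
  have hR₁M : R₁ ≤ M.toSubring := locAtCentre_le_subfield _ OE M hB₁M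
  -- (6) (47) from Prop. 8.1 (1): `G = u·xⱼ·x^{c} ∈ R₁′` for every `j`
  have hSR : ∀ c : k, algebraMap k E c ∈ R₁' := fun c => le_locAtCentre _ _ (B₁'.algebraMap_mem c)
  have hg : ∀ j : Fin d, r ≤ (j : ℕ) → ∃ (g : E) (w : S'ˣ) (c : Fin r → ℕ), g ∈ R₁' ∧
      g = ((w : S') : E) * ((x j : S') : E) * ∏ i, ((x (Fin.castLE hr i) : S') : E) ^ c i := by
    intro j _
    obtain ⟨G, u, c, hG, hGeq⟩ := exists_mem_eq_unit_mul_prod_pow OE t' hTO' R₁' hSR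
      (fun i => x (Fin.castLE hr i)) f₁ hf₁R w e hf₁ ht'f (x j)
    exact ⟨G, u, c, hG, hGeq⟩
  -- (7) density: "`R₁` lies dense in `R₁′`" ([CoP1] (44), tree `exists_finset_dense_locAtCentre`)
  have hdense : ∀ (n : ℕ) (y : E), y ∈ R₁' →
      ∃ a ∈ R₁, ∃ z : R₁', z ∈ maximalIdeal R₁' ^ n ∧ (z : E) = y - a :=
    fun n y hy => hdenseC K' hMK' hK'N hK'Z t₁ ht₁M hMt₁ ht₁O hnorm hct₁ t₁' ht₁'K' hext₁ hO₁' n y hy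
  have ha' : ∀ z : R₁', z ∈ maximalIdeal R₁' →
      Subring.inclusion h₁ z ∈ Ideal.span {∏ i : Fin r, x (Fin.castLE hr i)} :=
    fun z hz => ha (Subring.inclusion h₁ z) z.2 ((mem_maximalIdeal_locAtCentre_iff hO₁' z).mp hz)
  -- (8) (46)–(52) in dimension `d`: `Fᵢ, Hⱼ ∈ M ∩ 𝔪_{S′}` with `√((F,H)S′) = 𝔪_{S′}`
  obtain ⟨D, hD, F, H, hFM, hHM, hFm, hHm, hradFH⟩ :=
    exists_radical_eq_maximalIdeal_of_dense_fin S' R₁' h₁ R₁ M hR₁M hdense hr hr0 x hx0 hxm ha'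
      γ A hdet fm hfmM hfm hg
  -- (9) the model `k[t] := k[t′ ∪ {Fᵢ, Hⱼ}]` of `K′`: same local ring `S′`
  set tFH : Finset E := (Finset.univ.image fun i => ((F i : S') : E)) ∪
    (Finset.univ.image fun j => ((H j : S') : E)) with htFHdef
  have htFH_S' : ∀ z ∈ tFH, z ∈ S' := by
    intro z hz
    rcases Finset.mem_union.mp hz with h | h
    · obtain ⟨i, -, rfl⟩ := Finset.mem_image.mp h
      exact (F i).2
    · obtain ⟨j, -, rfl⟩ := Finset.mem_image.mp h
      exact (H j).2
  have htFH_M : ∀ z ∈ tFH, z ∈ M := by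
    intro z hz
    rcases Finset.mem_union.mp hz with h | h
    · obtain ⟨i, -, rfl⟩ := Finset.mem_image.mp h
      exact hFM i
    · obtain ⟨j, -, rfl⟩ := Finset.mem_image.mp h
      exact hHM j
  have htFH_v : ∀ z ∈ tFH, OE.valuation z < 1 := by
    intro z hz
    rcases Finset.mem_union.mp hz with h | h
    · obtain ⟨i, -, rfl⟩ := Finset.mem_image.mp h
      exact (mem_maximalIdeal_locAtCentre_iff hTO' (F i)).mp (hFm i)
    · obtain ⟨j, -, rfl⟩ := Finset.mem_image.mp h
      exact (mem_maximalIdeal_locAtCentre_iff hTO' (H j)).mp (hHm j)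
  have htFH_span : ∀ z : S', z ∈ Ideal.span (Set.range F ∪ Set.range H) →
      z ∈ Ideal.span {w : S' | (w : E) ∈ tFH} := by
    intro z hz
    refine (Ideal.span_mono ?_) hz
    rintro _ (⟨i, rfl⟩ | ⟨j, rfl⟩)
    · show ((F i : S') : E) ∈ tFH
      exact Finset.mem_union_left _ (Finset.mem_image.mpr ⟨i, Finset.mem_univ _, rfl⟩)
    · show ((H j : S') : E) ∈ tFH
      exact Finset.mem_union_right _ (Finset.mem_image.mpr ⟨j, Finset.mem_univ _, rfl⟩)
  set t : Finset E := t' ∪ tFH with htdef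
  set B : Subalgebra k E := Algebra.adjoin k (t : Set E) with hBdef
  have ht't : (t' : Set E) ⊆ (t : Set E) := Finset.coe_subset.mpr Finset.subset_union_left
  have htFHt : (tFH : Set E) ⊆ (t : Set E) := Finset.coe_subset.mpr Finset.subset_union_right
  have hB'B : B' ≤ B := Algebra.adjoin_mono ht't
  have hBS' : B.toSubring ≤ S' := model_toSubring_le_of_subset hkS' (fun z hz => by
    rcases Finset.mem_union.mp (Finset.mem_coe.mp hz) with h | h
    · exact hB'S' (Algebra.subset_adjoin (Finset.mem_coe.mpr h))
    · exact htFH_S' z h)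
  have hBO : B.toSubring ≤ OE.toSubring := hBS'.trans hS'O
  have hSB : locAtCentre B.toSubring OE = S' := by
    refine le_antisymm ?_ (locAtCentre_mono OE (fun z hz => hB'B hz))
    have h := locAtCentre_mono OE hBS'
    rw [hS'def, locAtCentre_locAtCentre] at h
    rw [hS'def]; exact h
  -- `Frac k[t₁ ∪ t₁′] = K′`, hence `K′ ⊆ Frac k[t]`
  have hB₁M' : ∀ b : B₁, (b : E) ∈ M := fun b => hB₁M b.2
  letI algB₁M : Algebra B₁ M := ((B₁.val : B₁ →+* E).codRestrict M hB₁M').toAlgebra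
  letI algB₁K : Algebra B₁ K'M :=
    ((B₁.val : B₁ →+* E).codRestrict K'M (fun b => (hmemK'M _).mpr (hMK' (hB₁M' b)))).toAlgebra
  haveI : IsScalarTower B₁ M K'M := IsScalarTower.of_algebraMap_eq fun _ => rfl
  haveI : IsScalarTower B₁ K'M E := IsScalarTower.of_algebraMap_eq fun _ => rfl
  haveI : FaithfulSMul B₁ M := (faithfulSMul_iff_algebraMap_injective B₁ M).mpr
    (fun a b hab => Subtype.ext (by
      have := congrArg (fun w : M => (w : E)) hab
      exact this))
  haveI : IsFractionRing B₁ M := by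
    refine IsFractionRing.of_field B₁ M fun z => ?_
    obtain ⟨a, ha, b, hb, -, hz⟩ := exists_div_of_mem_closure (t₁ : Set E) (hMt₁ z.2)
    exact ⟨⟨a, ha⟩, ⟨b, hb⟩, Subtype.ext hz⟩
  haveI : IsFractionRing (integralClosure B₁ K'M) K'M :=
    integralClosure.isFractionRing_of_finite_extension M K'M
  have hKB : ∀ z ∈ K', ∃ a ∈ B₁'.toSubring, ∃ b ∈ B₁'.toSubring, b ≠ 0 ∧ z = a / b := by
    intro z hz
    obtain ⟨a, b, hb, hab⟩ :=
      IsFractionRing.div_surjective (A := integralClosure B₁ K'M) (⟨z, (hmemK'M z).mpr hz⟩ : K'M)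
    have ha' : ((a : K'M) : E) ∈ B₁' :=
      hext _ (a : K'M).2 ((a.2 : IsIntegral B₁ (a : K'M)).map (IsScalarTower.toAlgHom B₁ K'M E))
    have hb' : ((b : K'M) : E) ∈ B₁' :=
      hext _ (b : K'M).2 ((b.2 : IsIntegral B₁ (b : K'M)).map (IsScalarTower.toAlgHom B₁ K'M E))
    have hb0 : ((b : K'M) : E) ≠ 0 := by
      intro h0
      apply nonZeroDivisors.ne_zero hb
      exact Subtype.ext (Subtype.ext h0)
    refine ⟨_, ha', _, hb', hb0, ?_⟩
    have := congrArg (fun w : K'M => (w : E)) hab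
    simpa using this.symm
  have hadj_cl : (B : Set E) ⊆ (Subfield.closure (Set.range (algebraMap k E) ∪ (t : Set E)) : Set E) := by
    intro z hz
    rw [SetLike.mem_coe, ← Subalgebra.mem_toSubring, hBdef, Algebra.adjoin_eq_ring_closure] at hz
    exact Subring.closure_le.mpr (fun w hw => Subfield.subset_closure hw) hz
  have hK't : K' ≤ Subfield.closure (Set.range (algebraMap k E) ∪ (t : Set E)) := by
    intro z hz
    obtain ⟨a, ha, b, hb, -, rfl⟩ := hKB z hz
    exact div_mem (hadj_cl (hB'B (hle' ha))) (hadj_cl (hB'B (hle' hb)))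
  -- (10) the quasi-finite data
  have hregB : IsRegularLocalRing (locAtCentre B.toSubring OE) := by rw [hSB]; exact hregS'
  have hfracS' : ∀ z ∈ S', ∃ a ∈ B, ∃ c ∈ B, OE.valuation c = 1 ∧ z = a / c := by
    intro z hz
    obtain ⟨a, ha, c, hc, hvc, rfl⟩ := hz
    exact ⟨a, hB'B ha, c, hB'B hc, hvc, rfl⟩
  refine ⟨t, ?_, fun z hz => hB'B (hle' (hB₁B₁' (hst₁ hz))), hBO, hK't, hregB, tFH,
    fun z hz => htFH_M z hz, fun z hz => Algebra.subset_adjoin (htFHt hz), htFH_v, ?_⟩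
  · intro z hz
    rcases Finset.mem_union.mp (Finset.mem_coe.mp hz) with h | h
    · exact ht'K' (Finset.mem_coe.mpr h)
    · exact hMK' (htFH_M z h)
  · intro y hy hvy
    let yS : S' := ⟨y, hBS' hy⟩
    have hyS : yS ∈ maximalIdeal S' := (mem_maximalIdeal_locAtCentre_iff hTO' yS).mpr hvy
    rw [← hradFH] at hyS
    obtain ⟨n, hn⟩ := hyS
    obtain ⟨b, hb, hvb, hmem⟩ :=
      exists_mul_mem_span_of_mem_span B OE S' hfracS' tFH (htFH_span _ hn)
    refine ⟨n, b, hb, hvb, ?_⟩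
    have : ((yS ^ n : S') : E) = y ^ n := by rw [Subring.coe_pow]
    rw [← this]; exact hmem

end Engine3

end Summit.ResolutionOfSingularities.ResolutionOfSingularities.Theorems.MonomialBlowupLU

end
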